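import Literature.AlgebraicTopology.SingularHomology.IntToCoeffClassNaturality
import Literature.AlgebraicTopology.SingularHomology.CoefficientCoordinateClasses
import Literature.AlgebraicTopology.SingularHomology.FundamentalClassProofs
import Literature.AlgebraicTopology.SingularHomology.RelativeKroneckerAbsolute
import HarnessLib

/-!
# The fundamental class of `μ ⊗ 1` is `[X] ⊗ 1`: change of coefficients commutes with passing to
# local homology, and with the fundamental class (Hatcher 2002, §3.3 p. 235 and Thm. 3.26)

Layer `Literature/AlgebraicTopology/SingularHomology`; THEOREMS ONLY (no definition, no named fact).
A. Hatcher, *Algebraic Topology* (2002), §3.3 p. 235: "an orientable manifold is `R`-orientable for all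
`R`" through `Hₙ(M | x) ⊗ R → Hₙ(M | x; R)`; Thm. 3.26 (a): the fundamental class is characterised by
its local images. The tree's `HomologicalOrientation.toCoeff R μ` is the `R`-orientation `x ↦ μₓ ⊗ 1`
of a `ℤ`-oriented manifold (`OrientationProofs`), built from `intToCoeffClass R K n :
Hₙ(X | K; ℤ) → Hₙ(X | K; R)` (the concrete change of coefficients `clocalHomology.coeffMap`
transported along the chosen comparison isomorphisms of the two models of local homology). This file
proves that the ABSOLUTE change of coefficients `singularHomology.coeffChange` (`HomologyRingChange`)
is compatible with it:

* `comparisonIso_hom_toLocalOfSet_coeffChange` — on the concrete model, `(c ⊗ 1)|_K = (c|_K) ⊗ 1`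
  (both are `[g ∘ z̃]` for a representing cycle `z̃`);
* `toLocalOfSet_coeffChange` — **`(c ⊗ 1)|_K = intToCoeffClass R K (c|_K)`** for every
  `c ∈ Hₙ(X; ℤ)` and every `K`;
* `HomologicalOrientation.isFundamentalClass_toCoeff_coeffChange`,
  **`HomologicalOrientation.fundamentalClass_toCoeff`** — on a closed manifold,
  `[X]_{μ ⊗ R} = [X]_μ ⊗ 1` (Thm. 3.26: both restrict to `μₓ ⊗ 1` at every point).

Consequence (`AlgebraicGeometry/HodgeTheory`): the rational and complex fundamental classes of a
smooth projective variety are the images of the INTEGRAL one, so Kronecker pairings of integral classes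
with `[X(ℂ)]` are integers (the trace normalisation of integral generators).

## References

* [HatcherAT2002] A. Hatcher, Algebraic Topology, CUP 2002, §2.2 p. 165, §3.3 p. 235 and Thm. 3.26.
-/

noncomputable section

-- chains of the concrete complex are `Finsupp`s up to unfolding (as in `HomologyRingChange`)
set_option backward.isDefEq.respectTransparency false

open CategoryTheory Limits

universe u

namespace Literature.AlgebraicTopology.SingularHomology

open singularChainComplex

variable (R : Type) [CommRing R] {X : Type u} [TopologicalSpace X]

/-! ### Change of coefficients commutes with passing to local homology -/

/-- The comparison applied to `c|_K`, for the comparison isomorphism `localHomologyOfSet.comparisonIso`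
of `OrientationProofs`: `cmp (c|_K) = π'_* ((C_• ≅ C)⁻¹_* c)` (both models compute `Hₙ(X, X ∖ K)` as
the homology of `C(X)/C(X ∖ K)`). [cite: HatcherAT2002, §2.1 (relative homology) and §3.3 p. 236] -/
theorem comparisonIso_hom_toLocalOfSet_eq (A : Type) [CommRing A] (K : Set X) (n : ℕ)
    (c : singularHomology A A X n) :
    (localHomologyOfSet.comparisonIso A A K n).hom (singularHomology.toLocalOfSet A A X K n c) =
      HomologicalComplex.homologyMap (awaySub A A X K).π n
        (HomologicalComplex.homologyMap (csingularChainComplex.compIso A A X).inv n c) := by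
  change (HomologicalComplex.homologyMap (relativeSingularChainComplex.π A A X Kᶜ) n ≫
      HomologicalComplex.homologyMap (awayComparisonIso A A K).hom n) c =
    (HomologicalComplex.homologyMap (csingularChainComplex.compIso A A X).inv n ≫
      HomologicalComplex.homologyMap (awaySub A A X K).π n) c
  rw [← HomologicalComplex.homologyMap_comp, ← HomologicalComplex.homologyMap_comp,
    π_comp_awayComparisonIso_hom]

/-- A homology class of the Mathlib model is the class of the underlying chain of a representing
cycle: `[z] = cls (ι z)`. [cite: HatcherAT2002, §2.1 (homology classes of cycles)] -/
theorem homologyπ_eq_homologyCls (A : Type) [CommRing A] (n : ℕ) (z : cycles A A X n) :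
    (singularChainComplex A A X).homologyπ n z =
      homologyCls (iCycles A A X n z) (d_iCycles _ z) := by
  rw [homologyCls_eq_homologyπ_cyclesMk _ _ ((ComplexShape.down ℕ).next n) rfl (d_iCycles _ z)]
  congr 1
  exact cycles_ext ((singularChainComplex A A X).i_cyclesMk _ _ _ _).symm

/-- **On the concrete model, `(c ⊗ 1)|_K = (c|_K) ⊗ 1`**: for `c ∈ Hₙ(X; ℤ)` and the additive map
`g : ℤ → R`, the comparison image of `(g_* c)|_K` is `coeffMap g` of the comparison image of `c|_K`
(both equal `[g ∘ z̃]` for the concrete cycle `z̃` of `c`). [cite: HatcherAT2002, §2.2 p. 165 and §3.3 p. 235] -/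
theorem comparisonIso_hom_toLocalOfSet_coeffChange (K : Set X) (n : ℕ) (c : singularHomology ℤ ℤ X n) :
    (localHomologyOfSet.comparisonIso R R K n).hom (singularHomology.toLocalOfSet R R X K n
        (singularHomology.coeffChange X (Int.castAddHom R) n c)) =
      clocalHomology.coeffMap ℤ R (Int.castAddHom R) K n
        ((localHomologyOfSet.comparisonIso ℤ ℤ K n).hom (singularHomology.toLocalOfSet ℤ ℤ X K n c)) := by
  induction c using singularHomology_induction_on with
  | h z =>
    set g : ℤ →+ R := Int.castAddHom R with hg
    -- the concrete cycles
    set w : (csingularChainComplex ℤ ℤ X).X n :=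
      (csingularChainComplex.compIso ℤ ℤ X).inv.f n (iCycles ℤ ℤ X n z) with hw
    have hw0 : (csingularChainComplex ℤ ℤ X).d n ((ComplexShape.down ℕ).next n) w = 0 :=
      d_hom_f_eq_zero _ _ (d_iCycles _ z)
    have hwS : (csingularChainComplex ℤ ℤ X).d n ((ComplexShape.down ℕ).next n) w ∈
        awaySub ℤ ℤ X K ((ComplexShape.down ℕ).next n) := by
      rw [hw0]; exact Submodule.zero_mem _
    set w' : (csingularChainComplex R R X).X n :=
      (csingularChainComplex.compIso R R X).inv.f n (iCycles R R X n (cyclesCoeffChange g n z)) with hw'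
    have hw'0 : (csingularChainComplex R R X).d n ((ComplexShape.down ℕ).next n) w' = 0 :=
      d_hom_f_eq_zero _ _ (d_iCycles _ _)
    have hw'S : (csingularChainComplex R R X).d n ((ComplexShape.down ℕ).next n) w' ∈
        awaySub R R X K ((ComplexShape.down ℕ).next n) := by
      rw [hw'0]; exact Submodule.zero_mem _
    -- the integral side: `cmp (c|_K) = relCls w`
    have hZ : (localHomologyOfSet.comparisonIso ℤ ℤ K n).hom
        (singularHomology.toLocalOfSet ℤ ℤ X K n ((singularChainComplex ℤ ℤ X).homologyπ n z)) =
        (awaySub ℤ ℤ X K).relCls w hwS := by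
      rw [comparisonIso_hom_toLocalOfSet_eq, homologyπ_eq_homologyCls, homologyMap_homologyCls,
        ← Subcomplex.homologyMap_π_homologyCls (awaySub ℤ ℤ X K) w hw0 hwS]
    -- the `R` side: `cmp ((g_* c)|_K) = relCls w'`
    have hR : (localHomologyOfSet.comparisonIso R R K n).hom
        (singularHomology.toLocalOfSet R R X K n
          (singularHomology.coeffChange X g n ((singularChainComplex ℤ ℤ X).homologyπ n z))) =
        (awaySub R R X K).relCls w' hw'S := by
      rw [singularHomology.coeffChange_homologyπ, comparisonIso_hom_toLocalOfSet_eq,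
        homologyπ_eq_homologyCls, homologyMap_homologyCls,
        ← Subcomplex.homologyMap_π_homologyCls (awaySub R R X K) w' hw'0 hw'S]
    -- the chain identity `w' = g ∘ w`
    have hchain : w' = (Finsupp.mapRange g (map_zero g) w : CChain R X n) := by
      rw [hw', hw, iCycles_cyclesCoeffChange]
      exact compInv_chainCoeffChange g n _
    rw [hR, hZ, clocalHomology.coeffMap_relCls]
    exact (awaySub R R X K).relCls_congr hchain _ _

/-- **`(c ⊗ 1)|_K = (c|_K) ⊗ 1`**: the absolute change of coefficients along `ℤ → R` followed by
passing to `Hₙ(X | K; R)` is `intToCoeffClass R K` of `c|_K` (Hatcher §3.3 p. 235: naturality of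
`Hₙ(X | K) ⊗ R → Hₙ(X | K; R)` in the pair). [cite: HatcherAT2002, §3.3 p. 235 and §2.2 p. 165] -/
theorem toLocalOfSet_coeffChange (K : Set X) (n : ℕ) (c : singularHomology ℤ ℤ X n) :
    singularHomology.toLocalOfSet R R X K n (singularHomology.coeffChange X (Int.castAddHom R) n c) =
      intToCoeffClass R K n (singularHomology.toLocalOfSet ℤ ℤ X K n c) := by
  rw [intToCoeffClass, ← comparisonIso_hom_toLocalOfSet_coeffChange, Iso.hom_inv_id_apply]

/-- Pointwise form: `(c ⊗ 1)|ₓ = (c|ₓ) ⊗ 1`. [cite: HatcherAT2002, §3.3 p. 235] -/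
theorem toLocal_coeffChange (x : X) (n : ℕ) (c : singularHomology ℤ ℤ X n) :
    singularHomology.toLocal R R x n (singularHomology.coeffChange X (Int.castAddHom R) n c) =
      intToCoeffClass R {x} n (singularHomology.toLocal ℤ ℤ x n c) :=
  toLocalOfSet_coeffChange R {x} n c

/-! ### The fundamental class of `μ ⊗ R` -/

variable [T2Space X] {n : ℕ} [ChartedSpace (EuclideanSpace ℝ (Fin n)) X] [CompactSpace X]

/-- **`[X]_μ ⊗ 1` is a fundamental class for `μ ⊗ R`** on a closed `ℤ`-oriented manifold: at every
point it restricts to `μₓ ⊗ 1` (`[X]_μ` restricts to `μₓ`, Thm. 3.26 (a), and restriction commutes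
with the change of coefficients). [cite: HatcherAT2002, §3.3 Thm. 3.26 (a) and p. 235] -/
theorem HomologicalOrientation.isFundamentalClass_toCoeff_coeffChange (μ : HomologicalOrientation ℤ X n) :
    IsFundamentalClass (μ.toCoeff R)
      (singularHomology.coeffChange X (Int.castAddHom R) n μ.fundamentalClass) := by
  intro x
  rw [toLocal_coeffChange, HomologicalOrientation.toCoeff_localClass,
    HomologicalOrientation.isFundamentalClass_fundamentalClass_holds n μ x]

/-- **`[X]_{μ ⊗ R} = [X]_μ ⊗ 1`**: the fundamental class of the `R`-orientation induced by a
`ℤ`-orientation of a closed manifold is the image of the integral fundamental class under the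
change of coefficients `ℤ → R` (uniqueness of fundamental classes, Thm. 3.26 / Lemma 3.27).
[cite: HatcherAT2002, §3.3 Thm. 3.26 and Lemma 3.27] -/
theorem HomologicalOrientation.fundamentalClass_toCoeff (μ : HomologicalOrientation ℤ X n) :
    (μ.toCoeff R).fundamentalClass =
      singularHomology.coeffChange X (Int.castAddHom R) n μ.fundamentalClass :=
  IsFundamentalClass.fundamentalClass_eq_holds R X n (μ.isFundamentalClass_toCoeff_coeffChange R)

end Literature.AlgebraicTopology.SingularHomology

end
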